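import Summits.MatrixMultiplication.OmegaCensus.DihedralLawAttainedCyclicAll
import Summits.MatrixMultiplication.OmegaCensus.C2DihedralLowerBound
import Summits.MatrixMultiplication.OmegaCensus.DihedralLikeLaw
import HarnessLib

/-!
# `β(C₂² × D_{2k}) = 16⌊2k/3⌋` for `k ≢ 1 (mod 3)`

ω-census, family (b3).  Framing: lottery ticket; floor = certified bounds/negative ranges.

`C₂² × D_{2k}` (`Multiplicative (ZMod 2) × (Multiplicative (ZMod 2) × DihedralGroup k)`) is the generalized dihedral
group of `A = ℤ₂ × ℤ₂ × ℤ_k`, never cyclic.  Upper bound: for `k ≡ 2 (mod 3)` (`|A| = 4k ≡ 2 (mod 3)`,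
`|A| ≥ 20`) the law gap gives `3V + 16 ≤ 32k`, i.e. `V ≤ 16⌊2k/3⌋` (`tpp_volume_le_law_sub_four_of_not_dihedral'`);
for `3 ∣ k` the dihedral-like law `4⌊8k/3⌋ = 16⌊2k/3⌋` (`tpp_volume_le_law_dihedralLike`).  Lower bound: the product
of `(C₂, 1, 1)` with the extremal triple of `C₂ × D_{2k}` (`tpp_volume_ge_c2_dihedral`), volume `2 · 8⌊2k/3⌋`.
Hence **`β(C₂² × D_{2k}) = 16⌊2k/3⌋ = 4 β(D_{2k})` for every `k ≥ 3`, `k ≢ 1 (mod 3)`** (`c22_dihedral_law`); for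
`k ≡ 2 (mod 3)` this is `4` below the dihedral-like law `4⌊8k/3⌋`.
-/

namespace Summit.MatrixMultiplication.OmegaCensus

open Literature.Combinatorics.Additive Finset
open Summit.MatrixMultiplication.MatrixMultiplication.Theorems.JuntaBranch.Planting (tpp_product)

/-- `ℤ₂ × (ℤ₂ × ℤ_k)` is not cyclic: every element is killed by `2k < 4k = |A|`. [folklore] -/
theorem not_cyclic_z2_z2_zmod {k : ℕ} [NeZero k] :
    ¬ ∃ g : ZMod 2 × (ZMod 2 × ZMod k), ∀ x, x ∈ AddSubgroup.zmultiples g := by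
  rintro ⟨g, hg⟩
  have htop : AddSubgroup.zmultiples g = ⊤ := (AddSubgroup.eq_top_iff' _).2 hg
  have hcard : addOrderOf g = 2 * (2 * k) := by
    rw [← Nat.card_zmultiples, htop, AddSubgroup.card_top, Nat.card_eq_fintype_card, Fintype.card_prod,
      Fintype.card_prod, ZMod.card, ZMod.card]
  have hk0 : (2 * k) • g = 0 := by
    obtain ⟨a, b, c⟩ := g
    refine Prod.ext ?_ (Prod.ext ?_ ?_)
    · show (2 * k) • a = 0
      rw [nsmul_eq_mul, Nat.cast_mul, ZMod.natCast_self, zero_mul, zero_mul]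
    · show (2 * k) • b = 0
      rw [nsmul_eq_mul, Nat.cast_mul, ZMod.natCast_self, zero_mul, zero_mul]
    · show (2 * k) • c = 0
      rw [nsmul_eq_mul, Nat.cast_mul, ZMod.natCast_self, mul_zero, zero_mul]
  have hdvd := addOrderOf_dvd_of_nsmul_eq_zero hk0
  rw [hcard] at hdvd
  have hkpos : 0 < k := Nat.pos_of_ne_zero (NeZero.ne k)
  have := Nat.le_of_dvd (by omega) hdvd
  omega

/-- **`β(C₂² × D_{2k}) = 16⌊2k/3⌋` for `k ≥ 3`, `k ≢ 1 (mod 3)`.** [folklore] -/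
theorem c22_dihedral_law {k : ℕ} [NeZero k] (hk : 3 ≤ k) (hmod : k % 3 ≠ 1) :
    (∀ S T U : Finset (Multiplicative (ZMod 2) × (Multiplicative (ZMod 2) × DihedralGroup k)),
        TripleProductProperty S T U → S.card * T.card * U.card ≤ 16 * (2 * k / 3)) ∧
    ∃ S T U : Finset (Multiplicative (ZMod 2) × (Multiplicative (ZMod 2) × DihedralGroup k)),
      TripleProductProperty S T U ∧ S.card * T.card * U.card = 16 * (2 * k / 3) := by
  -- the dihedral-like presentation over `A = ℤ₂ × (ℤ₂ × ℤ_k)`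
  have hρρ : ∀ a b : ZMod 2 × (ZMod 2 × ZMod k),
      ((Multiplicative.ofAdd a.1, (Multiplicative.ofAdd a.2.1, DihedralGroup.r a.2.2)) :
          Multiplicative (ZMod 2) × (Multiplicative (ZMod 2) × DihedralGroup k)) *
        (Multiplicative.ofAdd b.1, (Multiplicative.ofAdd b.2.1, DihedralGroup.r b.2.2)) =
        (Multiplicative.ofAdd (a + b).1, (Multiplicative.ofAdd (a + b).2.1, DihedralGroup.r (a + b).2.2)) :=
    fun a b => by
      simp only [Prod.mk_mul_mk, DihedralGroup.r_mul_r, ← ofAdd_add, Prod.fst_add, Prod.snd_add]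
  have hρτ : ∀ a b : ZMod 2 × (ZMod 2 × ZMod k),
      ((Multiplicative.ofAdd a.1, (Multiplicative.ofAdd a.2.1, DihedralGroup.r a.2.2)) :
          Multiplicative (ZMod 2) × (Multiplicative (ZMod 2) × DihedralGroup k)) *
        (Multiplicative.ofAdd b.1, (Multiplicative.ofAdd b.2.1, DihedralGroup.sr b.2.2)) =
        (Multiplicative.ofAdd (b - a).1, (Multiplicative.ofAdd (b - a).2.1, DihedralGroup.sr (b - a).2.2)) :=
    fun a b => by
      simp only [Prod.mk_mul_mk, DihedralGroup.r_mul_sr, ← ofAdd_add, Prod.fst_sub, Prod.snd_sub]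
      rw [sub_eq_add_neg b.1, ZMod.neg_eq_self_mod_two, add_comm b.1, sub_eq_add_neg b.2.1,
        ZMod.neg_eq_self_mod_two, add_comm b.2.1]
  have hτρ : ∀ a b : ZMod 2 × (ZMod 2 × ZMod k),
      ((Multiplicative.ofAdd a.1, (Multiplicative.ofAdd a.2.1, DihedralGroup.sr a.2.2)) :
          Multiplicative (ZMod 2) × (Multiplicative (ZMod 2) × DihedralGroup k)) *
        (Multiplicative.ofAdd b.1, (Multiplicative.ofAdd b.2.1, DihedralGroup.r b.2.2)) =
        (Multiplicative.ofAdd (a + b).1, (Multiplicative.ofAdd (a + b).2.1, DihedralGroup.sr (a + b).2.2)) :=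
    fun a b => by
      simp only [Prod.mk_mul_mk, DihedralGroup.sr_mul_r, ← ofAdd_add, Prod.fst_add, Prod.snd_add]
  have hττ : ∀ a b : ZMod 2 × (ZMod 2 × ZMod k),
      ((Multiplicative.ofAdd a.1, (Multiplicative.ofAdd a.2.1, DihedralGroup.sr a.2.2)) :
          Multiplicative (ZMod 2) × (Multiplicative (ZMod 2) × DihedralGroup k)) *
        (Multiplicative.ofAdd b.1, (Multiplicative.ofAdd b.2.1, DihedralGroup.sr b.2.2)) =
        (Multiplicative.ofAdd ((0 : ZMod 2 × (ZMod 2 × ZMod k)) + b - a).1,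
          (Multiplicative.ofAdd ((0 : ZMod 2 × (ZMod 2 × ZMod k)) + b - a).2.1,
            DihedralGroup.r ((0 : ZMod 2 × (ZMod 2 × ZMod k)) + b - a).2.2)) :=
    fun a b => by
      simp only [Prod.mk_mul_mk, DihedralGroup.sr_mul_sr, ← ofAdd_add, zero_add, Prod.fst_sub, Prod.snd_sub]
      rw [sub_eq_add_neg b.1, ZMod.neg_eq_self_mod_two, add_comm b.1, sub_eq_add_neg b.2.1,
        ZMod.neg_eq_self_mod_two, add_comm b.2.1]
  have hρ : Function.Injective fun p : ZMod 2 × (ZMod 2 × ZMod k) =>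
      ((Multiplicative.ofAdd p.1, (Multiplicative.ofAdd p.2.1, DihedralGroup.r p.2.2)) :
        Multiplicative (ZMod 2) × (Multiplicative (ZMod 2) × DihedralGroup k)) := by
    intro a b hab
    simp only [Prod.mk.injEq, DihedralGroup.r.injEq] at hab
    exact Prod.ext (Multiplicative.ofAdd.injective hab.1)
      (Prod.ext (Multiplicative.ofAdd.injective hab.2.1) hab.2.2)
  have hτ : Function.Injective fun p : ZMod 2 × (ZMod 2 × ZMod k) =>
      ((Multiplicative.ofAdd p.1, (Multiplicative.ofAdd p.2.1, DihedralGroup.sr p.2.2)) :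
        Multiplicative (ZMod 2) × (Multiplicative (ZMod 2) × DihedralGroup k)) := by
    intro a b hab
    simp only [Prod.mk.injEq, DihedralGroup.sr.injEq] at hab
    exact Prod.ext (Multiplicative.ofAdd.injective hab.1)
      (Prod.ext (Multiplicative.ofAdd.injective hab.2.1) hab.2.2)
  have hne : ∀ a b : ZMod 2 × (ZMod 2 × ZMod k),
      ((Multiplicative.ofAdd a.1, (Multiplicative.ofAdd a.2.1, DihedralGroup.r a.2.2)) :
          Multiplicative (ZMod 2) × (Multiplicative (ZMod 2) × DihedralGroup k)) ≠
        (Multiplicative.ofAdd b.1, (Multiplicative.ofAdd b.2.1, DihedralGroup.sr b.2.2)) :=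
    fun a b hab => by simp at hab
  have hsurj : ∀ g : Multiplicative (ZMod 2) × (Multiplicative (ZMod 2) × DihedralGroup k),
      (∃ a : ZMod 2 × (ZMod 2 × ZMod k),
          ((Multiplicative.ofAdd a.1, (Multiplicative.ofAdd a.2.1, DihedralGroup.r a.2.2)) : _) = g) ∨
        ∃ a : ZMod 2 × (ZMod 2 × ZMod k),
          ((Multiplicative.ofAdd a.1, (Multiplicative.ofAdd a.2.1, DihedralGroup.sr a.2.2)) : _) = g := by
    intro g
    obtain ⟨m, m', d⟩ := g
    cases d with
    | r i => exact Or.inl ⟨(Multiplicative.toAdd m, (Multiplicative.toAdd m', i)), rfl⟩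
    | sr i => exact Or.inr ⟨(Multiplicative.toAdd m, (Multiplicative.toAdd m', i)), rfl⟩
  have hcardA : Fintype.card (ZMod 2 × (ZMod 2 × ZMod k)) = 4 * k := by
    rw [Fintype.card_prod, Fintype.card_prod, ZMod.card, ZMod.card]; ring
  refine ⟨fun S T U h => ?_, ?_⟩
  · by_cases h3 : k % 3 = 2
    · have key := tpp_volume_le_law_sub_four_of_not_dihedral' hρρ hρτ hτρ hττ hρ hτ hne hsurj
        (by rw [hcardA]; omega) (by rw [hcardA]; omega) (Or.inl not_cyclic_z2_z2_zmod) h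
      rw [hcardA] at key
      omega
    · have key := tpp_volume_le_law_dihedralLike hρρ hρτ hτρ hττ hρ hτ hne hsurj (by rw [hcardA]; omega) h
      rw [hcardA] at key
      omega
  · obtain ⟨S, T, U, h, hvol⟩ := tpp_volume_ge_c2_dihedral k hk
    refine ⟨univ ×ˢ S, {1} ×ˢ T, {1} ×ˢ U, tpp_product tpp_univ_one_one h, ?_⟩
    rw [card_product, card_product, card_product, card_univ, card_singleton, Fintype.card_multiplicative,
      ZMod.card]
    linarith [hvol]

end Summit.MatrixMultiplication.OmegaCensus
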